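import Summits.ABC.StewartYu.PadicG3LevelsI
import Summits.ABC.StewartYu.PadicG3LevelStepHAlg
import HarnessLib

/-!
# Cell abc-stewartyu, crux `Y07Odd` (stmt-ABC-19658), line `gen3-slab-odd`: THE KUMMER HALF-STEP ON THE LEVEL INVARIANT
# (`(s, n) → (s+1, 0)`): from the vanishing at `|x| ≤ N` to the next family's vanishing at the odd `|x| ≤ 2N₁ − 1`

`Summits/ABC/StewartYu/PadicG3LevelStepH.lean` — cell `abc-stewartyu` (design HOME/p2/HALFSTEP-ODD.md; seat p2-g4, F-odd lead).  Theorems on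
`G3Setup`; no named fact; no parameters.  Composition of the landed pieces: the class-free extrapolation bound at the half point `s₁/2`
(`norm_g3F_le_of_zerosΦ`), the exponent-class data on two sign classes (`exists_expClass_pm`), the `ℂ_p` root data (`exists_halfStep_rootData`),
the separation (`classSums_eq_zero_of_norm_g3Φ_half_lt`), the identification of the surviving fibre with the pivot class and of the PM sign with
the new sign class (`PadicG3LevelStepHAlg`), the re-based halved exponents (`PadicG3HalfRebase`) and the triangular descent
(`descent_dirMoments_shift`).  RECORD INTERFACE (hypotheses, per odd `s₁` and order `τ`): pointwise integrality `D·(Hasse·zγpow·qEhG) ∈ ℤ`,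
total size `≤ Mb`, and the inequality `extrapolation bound < D/(4D²Mb(∏H α)³)^{2^{n+1}}`; the next-level `Y₀`-polynomials `R′` with
`(Hasse_{t₀}Rᵢ)(s₁/2) = c_{t₀}·(Hasse_{t₀}Rᵢ′)(s₁)`, `c_{t₀} ≠ 0`.

* `LvInvI.halfStep` — the new state `LvInvI R′ B″ w (sgnOf w) pv lo′ ⌊L/2⌋ P m {x odd, |x| ≤ 2N₁−1} T′` for the pivot class `B″` of a non-zero
  coefficient, `w = halfDiff v i₀`, `T′ + t ≤ T`.

References: Yu. V. Nesterenko, LNM 1819 (2003) §4.3; K. Yu, Compositio 74 (1990) Lemma 2.5, (2.101)–(2.106); Acta Math. 211 (2013) Lemma 5.4.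
-/

noncomputable section

open NormedSpace Finset Polynomial
open Literature.NumberTheory.Transcendental
open Literature.NumberTheory.Transcendental.PadicCW77 (condExp)
open Literature.NumberTheory.Transcendental.CW77.Setup (Tau tauNorm)
open scoped Nat

namespace Summit.ABC.StewartYu

namespace G3Setup

variable {p : ℕ} [Fact p.Prime] {S : G3Setup p} {ι : Type*}

namespace LvInvI

variable {R R' : ι → ℚ[X]} {B : Finset ι} {v : ι → Fin S.n → ℤ} {sgn pv : ι → ℤ} {lo : Fin S.n → ℤ} {L : Fin S.n → ℕ} {P : ℤ}
  {m N T : ℕ}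

/-- The summand of the PM class sums at `(s₁, τ)` without its sign and coefficient: `Hasse_{t₀}Rᵢ(s₁/2)·zγpow(vᵢ,t′)·qEhG α (rootExp L vᵢ s₁)`.
[folklore] -/
def hterm (S : G3Setup p) (R : ι → ℚ[X]) (v : ι → Fin S.n → ℤ) (L : Fin S.n → ℕ) (s₁ : ℤ) (τ : Tau S.n) (i : ι) : ℚ :=
  ((hasseDeriv τ.1 (R i)).eval ((s₁ : ℚ) / 2) * S.zγpow v i τ.2) * HalfMono.qEhG S.α (S.rootExp L (v i) s₁)

/-- `|Σ over a fibre| ≤ Σ |·|` summed over all fibres of a partition of `B` into the `2 · 2ⁿ` PM classes is `≤ Σ_{i∈B} |aᵢ|`. [folklore] -/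
theorem sum_abs_fibres_le [DecidableEq ι] (B : Finset ι) (k : ι → ℕ) (e : ι → Fin S.n → ℕ) (a : ι → ℚ) :
    ∑ T', |((∑ i ∈ (B.filter (fun i => Even (k i))) with HalfMono.SsetG (e i) = T', a i : ℚ) : ℝ)| +
      ∑ T', |((∑ i ∈ (B.filter (fun i => ¬ Even (k i))) with HalfMono.SsetG (e i) = T', a i : ℚ) : ℝ)| ≤
        ∑ i ∈ B, |(a i : ℝ)| := by
  classical
  have key : ∀ (B' : Finset ι), ∑ T', |((∑ i ∈ B' with HalfMono.SsetG (e i) = T', a i : ℚ) : ℝ)| ≤ ∑ i ∈ B', |(a i : ℝ)| := by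
    intro B'
    calc ∑ T', |((∑ i ∈ B' with HalfMono.SsetG (e i) = T', a i : ℚ) : ℝ)|
        ≤ ∑ T', ∑ i ∈ B' with HalfMono.SsetG (e i) = T', |(a i : ℝ)| := by
          refine sum_le_sum fun T' _ => ?_
          push_cast
          exact abs_sum_le_sum_abs _ _
      _ = ∑ i ∈ B', |(a i : ℝ)| := sum_fiberwise B' (fun i => HalfMono.SsetG (e i)) (fun i => |(a i : ℝ)|)
  have hsplit : ∑ i ∈ B, |(a i : ℝ)| = ∑ i ∈ B.filter (fun i => Even (k i)), |(a i : ℝ)| + ∑ i ∈ B.filter (fun i => ¬ Even (k i)), |(a i : ℝ)| :=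
    (sum_filter_add_sum_filter_not B (fun i => Even (k i)) _).symm
  rw [hsplit]
  exact add_le_add (key _) (key _)

/-- **THE HALF-STEP ON THE LEVEL INVARIANT.** [cite: Nesterenko2003, §4.3] [cite: Yu1990, Lemma 2.5] -/
theorem halfStep [DecidableEq ι] (h : S.LvInvI R B v sgn pv lo L P m {x : ℤ | |x| ≤ (N : ℤ)} T)
    (hΛ : ‖S.Λ / (S.b S.j₀ : ℚ_[p])‖ ≤ (p : ℝ)⁻¹) (hΛm : ‖S.Λ / (S.b S.j₀ : ℚ_[p])‖ ≤ (p : ℝ)⁻¹ ^ (m + 1))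
    {ζ : ℚ_[p]} (hζ : IsPrimitiveRoot ζ (p - 1)) (hζM : ζ ^ ((p - 1) / 2) = -1) (hζ1 : ‖ζ‖ = 1) (r : Fin S.n → ℕ)
    (hη : ∀ j, S.η j = ζ ^ r j)
    (hind : ∀ T₁ : Finset (Fin S.n), T₁.Nonempty → ¬ IsSquare (∏ j ∈ T₁, S.α j) ∧ ¬ IsSquare (-∏ j ∈ T₁, S.α j))
    {N₁ T' t : ℕ} (ht : 1 ≤ t) (hT : T' + t ≤ T)
    {Bw : ℝ} (hBw0 : 0 ≤ Bw) (hBw : ∀ i ∈ B, ∀ t₀ k, ‖(hw (p := p) R i t₀).coeff k‖ * ((p : ℝ) ^ m * Real.sqrt p) ^ k ≤ Bw)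
    (c : ℕ → ℚ) (hc : ∀ t₀, c t₀ ≠ 0)
    (hRR' : ∀ i ∈ B, ∀ (t₀ : ℕ) (s₁ : ℤ), (hasseDeriv t₀ (R i)).eval ((s₁ : ℚ) / 2) = c t₀ * (hasseDeriv t₀ (R' i)).eval (s₁ : ℚ))
    (D : ℤ → Tau S.n → ℕ) (hD : ∀ s₁ τ, 1 ≤ D s₁ τ) (Mb : ℤ → Tau S.n → ℝ) (hMb : ∀ s₁ τ, 1 ≤ Mb s₁ τ)
    (hint : ∀ (s₁ : ℤ) (τ : Tau S.n), ∀ i ∈ B, ∃ z : ℤ, (D s₁ τ : ℚ) * hterm S R v L s₁ τ i = z)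
    (hsize : ∀ (s₁ : ℤ) (τ : Tau S.n), ∑ i ∈ B, |((pv i : ℚ) * hterm S R v L s₁ τ i : ℝ)| ≤ Mb s₁ τ)
    (hineq : ∀ s₁ : ℤ, Odd s₁ → |s₁| ≤ (2 * N₁ - 1 : ℤ) → ∀ τ : Tau S.n, tauNorm τ + t ≤ T →
      max (Bw * ‖S.Λ / (S.b S.j₀ : ℚ_[p])‖ * (p : ℝ) ^ ((t - 1) / 2) * (p : ℝ) ^ condExp p (2 * N + 1) t)
        (Bw / ((p : ℝ) ^ m * Real.sqrt p) ^ ((2 * N + 1) * t)) <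
      (D s₁ τ : ℝ) / (4 * (D s₁ τ : ℝ) ^ 2 * Mb s₁ τ * CW77.heightProd S.α ^ 3) ^ (2 ^ (S.n + 1))) :
    ∃ i₀ ∈ B, pv i₀ ≠ 0 ∧
      S.LvInvI R' (S.pivotClass v sgn B i₀) (S.halfDiff v i₀) (S.sgnOf (S.halfDiff v i₀)) pv
        (fun j => -((v i₀ j - lo j) / 2)) (fun j => L j / 2) P m {x : ℤ | Odd x ∧ |x| ≤ (2 * N₁ - 1 : ℤ)} T' := by
  classical
  obtain ⟨i₀, hi₀B, hi₀⟩ := h.nonzero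
  refine ⟨i₀, hi₀B, hi₀, ?_⟩
  have hsub := S.pivotClass_subset v sgn B i₀
  have hpar : ∀ i ∈ S.pivotClass v sgn B i₀, ∀ j, 2 ∣ v i j - v i₀ j := fun i hi => (S.mem_pivotClass.mp hi).2.1
  have hsg : ∀ i ∈ S.pivotClass v sgn B i₀, sgn i = sgn i₀ := fun i hi => (S.mem_pivotClass.mp hi).2.2
  have hsgn0 : (sgn i₀ : ℚ_[p]) ≠ 0 := by rcases h.sgn_pm i₀ with h1 | h1 <;> rw [h1] <;> norm_num
  -- the new sign classes
  have hsq : ∀ i ∈ S.pivotClass v sgn B i₀, S.cls (S.halfDiff v i₀ i) ^ 2 = 1 := fun i hi =>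
    S.cls_halfDiff_sq v i₀ (hpar i hi) hsgn0 (by rw [h.cls i (hsub hi), hsg i hi]) (h.cls i₀ hi₀B)
  refine ⟨⟨i₀, S.self_mem_pivotClass hi₀B, hi₀⟩, fun i hi => h.bound i (hsub hi), ?_, ?_, fun i => S.sgnOf_pm _ i,
    fun i hi => S.cls_eq_sgnOf _ i (hsq i hi), ?_, ?_, ?_⟩
  · -- the new interval contains `0`
    intro j
    have h1 := h.box i₀ hi₀B j
    have h2 := h.lo_le j
    constructor <;> omega
  · -- the new box
    intro i hi j
    have h1 := h.box i (hsub hi) j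
    have h2 := h.box i₀ hi₀B j
    obtain ⟨cc, hcc⟩ := hpar i hi j
    have hw : S.halfDiff v i₀ i j = cc := by simp only [halfDiff]; rw [hcc, Int.mul_ediv_cancel_left _ two_ne_zero]
    rw [hw]
    constructor <;> omega
  · -- depth
    intro i hi
    exact S.norm_E_halfDiff_le v i₀ (hpar i hi) (h.slab i (hsub hi) i₀ hi₀B) hΛm
  · -- slab
    intro i hi i' hi'
    exact S.norm_Lsum_halfDiff_sub_le v i₀ (hpar i hi) (hpar i' hi') (h.slab i (hsub hi) i' (hsub hi'))
  · -- THE VANISHING at the odd points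
    intro s₁ hs₁ τ hτ
    obtain ⟨hs₁odd, hs₁le⟩ := hs₁
    -- data depending on `s₁` only: exponent class and roots
    obtain ⟨c₀, a, k, q, hclass, hq, hk⟩ := S.exists_expClass_pm hζ hζM r hη v B sgn h.sgn_pm h.cls h.abs_le s₁
    obtain ⟨ξ, ιC, ŝ, hξM, hι2, hξ, hσ, hŝ, hŝ1⟩ := S.exists_halfStep_rootData hζM hζ1 r hη
    have he : ∀ i ∈ B, ∏ j, S.sq j ^ (v i j * s₁) = (∏ j, S.ω j ^ (-((L j : ℤ) * |s₁|))) * ∏ j, S.sq j ^ (S.rootExp L (v i) s₁ j) :=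
      fun i hi => S.prod_sq_zpow_eq_unit_mul (h.abs_le i hi) s₁
    have hzeroΦ : ∀ x : ℤ, |x| ≤ (N : ℤ) → ∀ τ'' : Tau S.n, tauNorm τ'' < T → S.g3Φ R v B pv τ'' (x : ℚ_[p]) = 0 := by
      intro x hx τ'' hτ''
      rw [S.g3Φ_intCast_pm R v B sgn h.sgn_pm h.cls, h.vanish x hx τ'' hτ'', Rat.cast_zero]
    have hz : ‖(2 : ℚ_[p])⁻¹ * (s₁ : ℚ_[p])‖ ≤ 1 := by
      rw [norm_mul, norm_inv, PadicExp.norm_two_eq_one S.hp3, inv_one, one_mul]; exact Padic.norm_int_le_one _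
    have hδ : ∀ i, ((if sgn i = 1 then 0 else 1 : ℤ)) = 0 ∨ ((if sgn i = 1 then 0 else 1 : ℤ)) = 1 := fun i => by
      by_cases h1 : sgn i = 1 <;> simp [h1]
    -- the pivot class is the PM fibre of the pivot
    have hset : S.pivotClass v sgn B i₀ =
        (B.filter (fun i => (Even (k i) ↔ Even (k i₀)))).filter (fun i => HalfMono.SsetG (S.rootExp L (v i) s₁) =
          HalfMono.SsetG (S.rootExp L (v i₀) s₁)) := by
      ext i
      rw [S.mem_pivotClass, mem_filter, mem_filter]
      constructor
      · rintro ⟨hiB, hpr, hsgi⟩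
        refine ⟨⟨hiB, ?_⟩, (S.SsetG_eq_iff (h.abs_le i hiB) (h.abs_le i₀ hi₀B) hs₁odd).mpr hpr⟩
        refine (even_k_iff (δ := fun i => if sgn i = 1 then (0 : ℤ) else 1) hs₁odd (hk i hiB) (hk i₀ hi₀B) (hδ i) (hδ i₀)).mpr ?_
        rw [hsgi]
      · rintro ⟨⟨hiB, hev⟩, hss⟩
        refine ⟨hiB, (S.SsetG_eq_iff (h.abs_le i hiB) (h.abs_le i₀ hi₀B) hs₁odd).mp hss, ?_⟩
        have hd := (even_k_iff (δ := fun i => if sgn i = 1 then (0 : ℤ) else 1) hs₁odd (hk i hiB) (hk i₀ hi₀B) (hδ i) (hδ i₀)).mp hev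
        rcases h.sgn_pm i with h1 | h1 <;> rcases h.sgn_pm i₀ with h2 | h2 <;> simp [h1, h2] at hd ⊢
    -- (1)–(4): the fibre identity at every order `τ'` in range
    have hfibAll : ∀ τ' : Tau S.n, tauNorm τ' + t ≤ T →
        ∑ i ∈ S.pivotClass v sgn B i₀, (((-1) ^ (k i / 2) * pv i : ℤ) : ℚ) * hterm S R v L s₁ τ' i = 0 := by
      intro τ' hτ'
      have hbound := (S.norm_g3F_le_of_zerosΦ R v m B h.depth pv ht hBw0 hBw hΛ hzeroΦ hz τ' hτ').2
      have hlt := lt_of_le_of_lt hbound (hineq s₁ hs₁odd hs₁le τ' hτ')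
      have hsep := S.classSums_eq_zero_of_norm_g3Φ_half_lt R v B pv τ' s₁ _ (S.norm_unit_eq_one L s₁)
        (fun i => S.rootExp L (v i) s₁) he ŝ ξ ιC r k hσ hξM hι2 hξ hclass hŝ hŝ1 hind (hD s₁ τ') (hMb s₁ τ') ?_ ?_ ?_ hlt
      rotate_left
      · intro T₁
        have : ∀ i ∈ (B.filter (fun i => Even (k i))).filter (fun i => HalfMono.SsetG (S.rootExp L (v i) s₁) = T₁),
            ∃ z : ℤ, (D s₁ τ' : ℚ) * ((((-1) ^ (k i / 2) * pv i : ℤ) : ℚ) * hterm S R v L s₁ τ' i) = z := by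
          intro i hi
          have hiB : i ∈ B := (mem_filter.mp (mem_filter.mp hi).1).1
          obtain ⟨z, hz⟩ := hint s₁ τ' i hiB
          exact ⟨(-1) ^ (k i / 2) * pv i * z, by push_cast; rw [← hz]; ring⟩
        choose! z hz using this
        refine ⟨∑ i ∈ (B.filter (fun i => Even (k i))).filter (fun i => HalfMono.SsetG (S.rootExp L (v i) s₁) = T₁), z i, ?_⟩
        rw [mul_sum]; push_cast
        exact sum_congr rfl fun i hi => by rw [← hz i hi]; unfold hterm; push_cast; ring
      · intro T₁
        have : ∀ i ∈ (B.filter (fun i => ¬ Even (k i))).filter (fun i => HalfMono.SsetG (S.rootExp L (v i) s₁) = T₁),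
            ∃ z : ℤ, (D s₁ τ' : ℚ) * ((((-1) ^ (k i / 2) * pv i : ℤ) : ℚ) * hterm S R v L s₁ τ' i) = z := by
          intro i hi
          have hiB : i ∈ B := (mem_filter.mp (mem_filter.mp hi).1).1
          obtain ⟨z, hz⟩ := hint s₁ τ' i hiB
          exact ⟨(-1) ^ (k i / 2) * pv i * z, by push_cast; rw [← hz]; ring⟩
        choose! z hz using this
        refine ⟨∑ i ∈ (B.filter (fun i => ¬ Even (k i))).filter (fun i => HalfMono.SsetG (S.rootExp L (v i) s₁) = T₁), z i, ?_⟩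
        rw [mul_sum]; push_cast
        exact sum_congr rfl fun i hi => by rw [← hz i hi]; unfold hterm; push_cast; ring
      · have hs := sum_abs_fibres_le (S := S) B k (fun i => S.rootExp L (v i) s₁)
          (fun i => (((-1) ^ (k i / 2) * pv i : ℤ) : ℚ) * hterm S R v L s₁ τ' i)
        refine le_trans (le_of_eq ?_) (hs.trans (le_trans (le_of_eq ?_) (hsize s₁ τ')))
        · unfold hterm; rfl
        · refine sum_congr rfl fun i _ => ?_
          push_cast
          rw [abs_mul, abs_mul, abs_mul, abs_pow, abs_neg, abs_one, one_pow, one_mul, ← abs_mul]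
      -- the fibre of the pivot
      obtain ⟨hC₀, hC₁⟩ := hsep
      rw [hset]
      rcases Nat.even_or_odd (k i₀) with hev₀ | hodd₀
      · have hfilt : B.filter (fun i => (Even (k i) ↔ Even (k i₀))) = B.filter (fun i => Even (k i)) :=
          filter_congr fun i _ => by simp [hev₀]
        rw [hfilt]
        have := congrFun hC₀ (HalfMono.SsetG (S.rootExp L (v i₀) s₁))
        simpa [hterm] using this
      · have hfilt : B.filter (fun i => (Even (k i) ↔ Even (k i₀))) = B.filter (fun i => ¬ Even (k i)) :=
          filter_congr fun i _ => by simp [Nat.not_even_iff_odd.mpr hodd₀]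
        rw [hfilt]
        have := congrFun hC₁ (HalfMono.SsetG (S.rootExp L (v i₀) s₁))
        simpa [hterm] using this
    -- (5) the fibre identity in terms of the new family
    have hK0 : (∏ j, S.α j ^ ((L j : ℤ) * |s₁| + v i₀ j * s₁ / 2) : ℚ) ≠ 0 :=
      prod_ne_zero_iff.mpr fun j _ => zpow_ne_zero _ (S.α_ne j)
    have hsign : ∀ i ∈ S.pivotClass v sgn B i₀,
        ((-1 : ℚ)) ^ (k i / 2) = (-1 : ℚ) ^ (k i₀ / 2) * (S.sgnOf (S.halfDiff v i₀) i : ℚ) := by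
      intro i hi
      have hiB := hsub hi
      have hδi : (if sgn i = 1 then (0 : ℤ) else 1) = (if sgn i₀ = 1 then (0 : ℤ) else 1) := by rw [hsg i hi]
      have hki := hk i hiB
      rw [hδi] at hki
      have hqi := hq i hiB
      rw [hδi] at hqi
      have h1 := negOnePow_half_k (p := p) hs₁odd hki (hk i₀ hi₀B)
      have h2 := S.cls_halfDiff_eq hζ hζM r hη (hpar i hi) hqi (hq i₀ hi₀B)
      have h3 := S.cls_eq_sgnOf (S.halfDiff v i₀) i (hsq i hi)
      rw [← h2, h3] at h1
      have h1' : (((-1 : ℚ) ^ (k i / 2) : ℚ) : ℚ_[p]) = ((((-1 : ℚ) ^ (k i₀ / 2) * (S.sgnOf (S.halfDiff v i₀) i : ℚ)) : ℚ) : ℚ_[p]) := by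
        push_cast; exact h1
      exact_mod_cast (Rat.cast_injective (α := ℚ_[p])) h1'
    -- the `t`-independent weights of the new family at `(s₁, τ.1)`
    set W : ι → ℚ := fun i => (S.sgnOf (S.halfDiff v i₀) i : ℚ) * pv i * (hasseDeriv τ.1 (R' i)).eval (s₁ : ℚ) *
      ∏ j, S.α j ^ (S.halfDiff v i₀ i j * s₁) with hW
    have hterm_eq : ∀ i ∈ S.pivotClass v sgn B i₀, ∀ t' : Fin S.n → ℕ,
        (((-1) ^ (k i / 2) * pv i : ℤ) : ℚ) * hterm S R v L s₁ (τ.1, t') i =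
        ((-1 : ℚ) ^ (k i₀ / 2) * c τ.1 * ∏ j, S.α j ^ ((L j : ℤ) * |s₁| + v i₀ j * s₁ / 2)) *
          (W i * ∏ k', S.zγ (v i) k' ^ t' k') := by
      intro i hi t'
      have hiB := hsub hi
      unfold hterm
      rw [hRR' i hiB τ.1 s₁, S.qEhG_rootExp_of_shift (h.abs_le i hiB) (S.eq_add_two_smul_halfDiff v i₀ (hpar i hi)) s₁]
      push_cast
      rw [hsign i hi]
      simp only [hW, zγpow]
      ring
    have hold : ∀ t' : Fin S.n → ℕ, ∑ k', t' k' ≤ T' - 1 - τ.1 →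
        ∑ i ∈ S.pivotClass v sgn B i₀, W i * ∏ k', S.zγ (v i) k' ^ t' k' = 0 := by
      intro t' ht'
      have hτ' : tauNorm ((τ.1, t') : Tau S.n) + t ≤ T := by
        unfold tauNorm at hτ ⊢; simp only at hτ ⊢; omega
      have h0 := hfibAll (τ.1, t') hτ'
      rw [sum_congr rfl fun i hi => hterm_eq i hi t', ← mul_sum] at h0
      rcases mul_eq_zero.mp h0 with h1 | h1
      · exfalso
        refine (mul_ne_zero (mul_ne_zero (pow_ne_zero _ (by norm_num)) (hc τ.1)) hK0) h1
      · exact h1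
    -- (6) triangular descent to the halved exponents
    have hnew := S.descent_dirMoments_shift v (S.halfDiff v i₀) (S.pivotClass v sgn B i₀) (fun k' => S.zγ (v i₀) k') two_ne_zero
      (fun i hi k' => S.zγ_halfDiff v i₀ (hpar i hi) k') W (T' - 1 - τ.1) hold
    have hτ2 : ∑ k', τ.2 k' ≤ T' - 1 - τ.1 := by unfold tauNorm at hτ; omega
    have hfin := hnew τ.2 hτ2
    -- (7) this is the new vanishing
    unfold g3φ
    rw [← hfin]
    refine sum_congr rfl fun i _ => ?_
    have hodd1 : s₁.natAbs % 2 = 1 := Nat.odd_iff.mp (Int.natAbs_odd.mpr hs₁odd)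
    simp only [hW, pvx, hodd1, pow_one, zγpow]
    push_cast
    ring

end LvInvI

end G3Setup

end Summit.ABC.StewartYu

end
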